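import Summits.CriticalPhenomena.CardyFormulaZ2.Theorems.CardyFlipRussoJitteredTriangularLegLevel

/-!
# `JitteredTriangularLeg` at `σ = 0`: discrete approximations with the continuum sandwich

Helper file for the support item `JitteredTriangularLeg` (stmt-CriticalPhenomena-6436) of route
`CardyFlipRusso`, continuing `CardyFlipRussoJitteredTriangularLegLevel.lean`: Bollobás–Riordan's
Lemma 14 with the sandwich (19) (*Percolation* (2006), Ch. 7, p. 184) for the CONTINUUM crossing
probability — `cont_exists_discreteApprox`, a copy of the tree's `tri_exists_discreteApprox_proof`
(`TriApproxDomainAssembly.lean`: marked inner approximations of the collar domains, diagonal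
selection of levels) fed with `cont_level_m` / `cont_level_p`.

## References

* B. Bollobás, O. Riordan, *Percolation*, Cambridge University Press (2006), Ch. 7 Lemma 14
  p. 184, (19), proof pp. 187–195.
-/

noncomputable section

open MeasureTheory Set Metric
open scoped Pointwise

namespace Summit.CriticalPhenomena.CardyFormulaZ2.Theorems

open Literature.Probability.Percolation Literature.Probability.LatticeModels
  Literature.Probability.RandomPlanarGeometry Literature.Topology.PlaneTopology

section ContApprox

local notation3 "contProb[" R ", " δ "]" => MeasureTheory.Measure.real (sitePercolation (Site 2) half)
  {ω : Set (Site 2) | voronoiCrossing (JordanDomain.carrier (MarkedDomain.toJordanDomain R))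
    (MarkedDomain.arc R 0) (MarkedDomain.arc R 2) δ (triEmbed '' ω) (triEmbed '' ωᶜ)}

open Filter Topology

/-- **Lemma 14 of Bollobás–Riordan 2006, Ch. 7, with the sandwich (19), for the continuum
crossing event** (copy of `tri_exists_discreteApprox_proof` with `cont_level_m` / `cont_level_p`):
for a conformal rectangle with an anticlockwise Carleson datum there are discrete approximations
`G_δ⁻`, `G_δ⁺` (`IsDiscreteApprox`) with
`P(G_δ⁻ crossed) - o(1) ≤ P_{1/2}(continuum crossing of closure Ω at mesh δ) ≤ P(G_δ⁺ crossed) + o(1)`.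
[cite: BollobasRiordan2006, Ch. 7 Lemma 14 p. 184, (19), remark p. 195] -/
theorem cont_exists_discreteApprox (R : ConformalRectangle) (a b c d : ℂ)
    (ψ : ConformalEquiv R.carrier (openTriangle a b c)) (habc : IsEquilateral a b c)
    (_hd : d ∈ openSegment ℝ c a) (hψ : IsCarlesonMap R a b c d ψ) (hturn : triangleTurn a b c = triOmega) :
    ∃ Gm Gp : ℝ → TriMarkedDomain 4, IsDiscreteApprox R Gm ∧ IsDiscreteApprox R Gp ∧
      ∃ e : ℝ → ℝ, Tendsto e (𝓝[>] 0) (𝓝 0) ∧ ∀ᶠ δ in 𝓝[>] (0 : ℝ),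
        (Gm δ).openCrossingProb 0 2 - e δ ≤ contProb[R, δ] ∧ contProb[R, δ] ≤ (Gp δ).openCrossingProb 0 2 + e δ := by
  classical
  have hR1 : ∀ z ∈ R.carrier, R.index z = 1 := fun z hz => index_eq_one_of_isCarlesonMap R ψ habc hψ hturn hz
  obtain ⟨T⟩ := R.toJordanDomain.nonempty_tubeData
  have hc : ∀ γ > (0 : ℝ), ∃ η > (0 : ℝ), ∃ ε₁ > (0 : ℝ), ∀ (σ : Fin 4 → ℝ) (hσ1 : ∀ i, σ i = 1 ∨ σ i = -1) (h : ℝ) (hh : 0 < h)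
      (hh1 : h ≤ 1 / 2), h ≤ ε₁ → T.z₀ ∈ (R.collarRect T (MarkedDomain.abs_le_one_of_sign hσ1) hh hh1).carrier →
      ∃ δ₁ > (0 : ℝ), ∀ (δ : ℝ) (hδ : 0 < δ)
        (hc₀ : baseSite T.z₀ δ ∈ innerCoarse (R.collarRect T (MarkedDomain.abs_le_one_of_sign hσ1) hh hh1).carrier δ), δ < δ₁ →
        (∀ x ∈ (innerApprox (R.collarRect T (MarkedDomain.abs_le_one_of_sign hσ1) hh hh1).toJordanDomain hδ hc₀).verts,
          ∀ y ∈ (innerApprox (R.collarRect T (MarkedDomain.abs_le_one_of_sign hσ1) hh hh1).toJordanDomain hδ hc₀).verts,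
            dist (triMeshPoint δ x) (triMeshPoint δ y) < η →
            PathIn triGraph (((innerApprox (R.collarRect T (MarkedDomain.abs_le_one_of_sign hσ1) hh hh1).toJordanDomain hδ hc₀).verts :
              Set (Site 2)) ∩ {v | dist (triMeshPoint δ x) (triMeshPoint δ v) < γ}) x y) ∧
        (∀ w ∈ triFacesIn (innerApprox (R.collarRect T (MarkedDomain.abs_le_one_of_sign hσ1) hh hh1).toJordanDomain hδ hc₀).verts,
          ∀ z ∈ triFacesIn (innerApprox (R.collarRect T (MarkedDomain.abs_le_one_of_sign hσ1) hh hh1).toJordanDomain hδ hc₀).verts,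
            dist ((δ : ℂ) * hexCenter w) ((δ : ℂ) * hexCenter z) < η →
            Relation.ReflTransGen (fun F F' : HexVertex => hexGraph.Adj F F' ∧
              F' ∈ triFacesIn (innerApprox (R.collarRect T (MarkedDomain.abs_le_one_of_sign hσ1) hh hh1).toJordanDomain hδ hc₀).verts ∧
              dist ((δ : ℂ) * hexCenter w) ((δ : ℂ) * hexCenter F') < 2 * γ) w z) := by
    intro γ hγ
    obtain ⟨ηs, hηs, hsite⟩ := site_conn_collar R T hγ
    obtain ⟨ηf, hηf, hface⟩ := face_conn_collar R T hγ
    refine ⟨min ηs ηf, lt_min hηs hηf, 1, one_pos, fun σ hσ1 h hh hh1 _ _ => ⟨min ηs ηf, lt_min hηs hηf, fun δ hδ hc₀ hδlt => ⟨?_, ?_⟩⟩⟩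
    · intro x hx y hy hxy
      exact hsite σ _ h hh hh1 δ hδ hc₀ (hδlt.trans_le (min_le_left _ _)) x hx y hy (hxy.trans_le (min_le_left _ _))
    · intro w hw z hz hwz
      exact hface σ _ h hh hh1 δ hδ hc₀ (hδlt.trans_le (min_le_right _ _)) w hw z hz (hwz.trans_le (min_le_right _ _))
  choose η hη ε₁ hε₁ hck using fun k : ℕ => hc (1 / ((k : ℝ) + 1)) (by positivity)
  set θ : ℕ → ℝ := fun k => min (ε₁ k) (1 / ((k : ℝ) + 1)) with hθ
  have hθ0 : ∀ k, 0 < θ k := fun k => lt_min (hε₁ k) (by positivity)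
  set P : ℝ → ℝ → Prop := fun ε δ => ∃ Gm Gp : TriMarkedDomain 4,
    (LevelProp R T η θ ε δ Gm ∧ Gm.openCrossingProb 0 2 ≤ contProb[R, δ] + ε) ∧
    (LevelProp R T η θ ε δ Gp ∧ contProb[R, δ] ≤ Gp.openCrossingProb 0 2 + ε) with hP
  have hPall : ∀ ε > 0, ∃ δ₀ > 0, ∀ δ, 0 < δ → δ < δ₀ → P ε δ := by
    intro ε hε
    obtain ⟨hm, hhm, hhm1, hmε, hz₀m, δm, hδm, hlevm⟩ := cont_level_m R T hR1 hε
    obtain ⟨hp, hhp, hhp1, hpε, hz₀p, δp, hδp, hlevp⟩ := cont_level_p R T hR1 hε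
    have hkN : ∀ k : ℕ, ε ≤ θ k → k < ⌈1 / ε⌉₊ + 1 := by
      intro k hk
      have h1 : ε ≤ 1 / ((k : ℝ) + 1) := hk.trans (min_le_right _ _)
      have h2 : (k : ℝ) + 1 ≤ 1 / ε := by
        rw [le_div_iff₀ hε]; rw [le_div_iff₀ (by positivity)] at h1; linarith
      have h3 : (k : ℝ) < ⌈1 / ε⌉₊ + 1 := by linarith [Nat.le_ceil (1 / ε)]
      exact_mod_cast h3
    have hdm : ∀ k, ∃ d > (0 : ℝ), ε ≤ θ k → ∀ (δ : ℝ) (hδ : 0 < δ)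
        (hc₀ : baseSite T.z₀ δ ∈ innerCoarse (R.collarRect T (MarkedDomain.abs_le_one_of_sign σm_sign) hhm hhm1).carrier δ), δ < d → _ :=
      fun k => by
        by_cases hk : ε ≤ θ k
        · obtain ⟨δ₁, hδ₁, h⟩ := hck k σm σm_sign hm hhm hhm1 (hmε.trans (hk.trans (min_le_left _ _))) hz₀m
          exact ⟨δ₁, hδ₁, fun _ => h⟩
        · exact ⟨1, one_pos, fun h => absurd h hk⟩
    choose dm hdm0 hdmk using hdm
    have hdp : ∀ k, ∃ d > (0 : ℝ), ε ≤ θ k → ∀ (δ : ℝ) (hδ : 0 < δ)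
        (hc₀ : baseSite T.z₀ δ ∈ innerCoarse (R.collarRect T (MarkedDomain.abs_le_one_of_sign σp_sign) hhp hhp1).carrier δ), δ < d → _ :=
      fun k => by
        by_cases hk : ε ≤ θ k
        · obtain ⟨δ₁, hδ₁, h⟩ := hck k σp σp_sign hp hhp hhp1 (hpε.trans (hk.trans (min_le_left _ _))) hz₀p
          exact ⟨δ₁, hδ₁, fun _ => h⟩
        · exact ⟨1, one_pos, fun h => absurd h hk⟩
    choose dp hdp0 hdpk using hdp
    obtain ⟨Dm, hDm, hDmk⟩ := exists_pos_le_forall_lt hdm0 (⌈1 / ε⌉₊ + 1)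
    obtain ⟨Dp, hDp, hDpk⟩ := exists_pos_le_forall_lt hdp0 (⌈1 / ε⌉₊ + 1)
    refine ⟨min (min δm δp) (min Dm Dp), by positivity, fun δ hδ hδlt => ?_⟩
    have hδm' : δ < δm := hδlt.trans_le ((min_le_left _ _).trans (min_le_left _ _))
    have hδp' : δ < δp := hδlt.trans_le ((min_le_left _ _).trans (min_le_right _ _))
    have hδDm : δ < Dm := hδlt.trans_le ((min_le_right _ _).trans (min_le_left _ _))
    have hδDp : δ < Dp := hδlt.trans_le ((min_le_right _ _).trans (min_le_right _ _))
    obtain ⟨hc₀m, Gm, hGmv, harcm, hfillm, hdensem, hsandm⟩ := hlevm δ hδ hδm'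
    obtain ⟨hc₀p, Gp, hGpv, harcp, hfillp, hdensep, hsandp⟩ := hlevp δ hδ hδp'
    refine ⟨Gm, Gp, ⟨⟨harcm, hfillm, hdensem, fun k hk => ?_⟩, hsandm⟩, ⟨⟨harcp, hfillp, hdensep, fun k hk => ?_⟩, hsandp⟩⟩
    · have := hdmk k hk δ hδ hc₀m ((hδDm.trans_le (hDmk k (hkN k hk))))
      rw [← hGmv] at this
      exact this
    · have := hdpk k hk δ hδ hc₀p ((hδDp.trans_le (hDpk k (hkN k hk))))
      rw [← hGpv] at this
      exact this
  obtain ⟨e, he, hepos, heP⟩ := exists_scale_tendsto hPall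
  obtain ⟨δs, hδs⟩ := heP.exists
  set G₀ : TriMarkedDomain 4 := hδs.choose with hG₀
  set Gm : ℝ → TriMarkedDomain 4 := fun δ => if hPδ : P (e δ) δ then hPδ.choose else G₀ with hGm
  set Gp : ℝ → TriMarkedDomain 4 := fun δ => if hPδ : P (e δ) δ then hPδ.choose_spec.choose else G₀ with hGp
  have hspec : ∀ δ, P (e δ) δ →
      (LevelProp R T η θ (e δ) δ (Gm δ) ∧ (Gm δ).openCrossingProb 0 2 ≤ contProb[R, δ] + e δ) ∧
      (LevelProp R T η θ (e δ) δ (Gp δ) ∧ contProb[R, δ] ≤ (Gp δ).openCrossingProb 0 2 + e δ) := by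
    intro δ hPδ
    have h1 : Gm δ = hPδ.choose := by simp only [hGm, dif_pos hPδ]
    have h2 : Gp δ = hPδ.choose_spec.choose := by simp only [hGp, dif_pos hPδ]
    rw [h1, h2]
    exact hPδ.choose_spec.choose_spec
  have he2 : Tendsto (fun δ => 2 * e δ) (𝓝[>] 0) (𝓝 0) := by simpa using he.const_mul 2
  have hsmall : ∀ c > 0, ∀ᶠ δ in 𝓝[>] (0 : ℝ), e δ < c := fun c hc => he (Iio_mem_nhds hc)
  have happrox : ∀ (G : ℝ → TriMarkedDomain 4), (∀ᶠ δ in 𝓝[>] (0 : ℝ), LevelProp R T η θ (e δ) δ (G δ)) → IsDiscreteApprox R G := by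
    intro G hG
    refine ⟨⟨fun δ => 2 * e δ, he2, hG.mono fun δ hδ i => ⟨fun z hz => ?_, fun y hy => ?_⟩⟩,
      ⟨fun δ => 2 * e δ, he2, hG.mono fun δ hδ z hz => ?_⟩, fun K hK hKΩ => ?_, fun γ hγ => ?_, fun γ hγ => ?_⟩
    · obtain ⟨y, hy, hd⟩ := (hδ.arcs i).2 z hz
      exact ⟨_, ⟨y, hy, rfl⟩, by rw [dist_comm]; exact hd.le⟩
    · obtain ⟨y', hy', rfl⟩ := hy
      obtain ⟨z, hz, hd⟩ := (hδ.arcs i).1 y' hy'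
      exact ⟨z, hz, hd.le⟩
    · obtain ⟨w, hw, hd⟩ := hδ.dense z hz
      exact ⟨w, hw, hd.le⟩
    · have hKc : IsCompact (T.Ci.φ.symm '' K) := hK.image_of_continuousOn (T.Ci.φ.symm.continuousOn.mono hKΩ)
      have hKball : T.Ci.φ.symm '' K ⊆ ball (0 : ℂ) 1 := by
        rintro _ ⟨x, hx, rfl⟩
        have := T.Ci.φ.symm.toPartialEquiv.map_source (x := x) (by rw [T.Ci.φ.symm.source_eq]; exact hKΩ hx)
        rwa [T.Ci.φ.symm.target_eq] at this
      obtain ⟨r, hr1, hKr⟩ : ∃ r < 1, ∀ u ∈ T.Ci.φ.symm '' K, ‖u‖ ≤ r := by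
        rcases (T.Ci.φ.symm '' K).eq_empty_or_nonempty with h0 | hne
        · exact ⟨0, one_pos, by rw [h0]; simp⟩
        · obtain ⟨u₀, hu₀, hmax⟩ := hKc.exists_isMaxOn hne continuous_norm.continuousOn
          exact ⟨‖u₀‖, mem_ball_zero_iff.1 (hKball hu₀), fun u hu => hmax hu⟩
      filter_upwards [hG, hsmall ((1 - r) / 2) (by linarith)] with δ hδ hδs x hx
      refine hδ.fill x ⟨T.Ci.φ.symm (triMeshPoint δ x), mem_closedBall_zero_iff.2 ?_, ?_⟩
      · linarith [hKr _ ⟨_, hx, rfl⟩]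
      · have hxΩ := hKΩ hx
        rw [T.Ci.eqOn (hKball ⟨_, hx, rfl⟩)]
        exact T.Ci.φ.apply_symm_apply hxΩ
    · obtain ⟨k, hk⟩ := exists_nat_one_div_lt hγ
      refine ⟨η k, hη k, ?_⟩
      filter_upwards [hG, hsmall (θ k) (hθ0 k)] with δ hδ hδs x hx y hy hxy
      exact (hδ.conn k hδs.le).1 x hx y hy hxy |>.mono (inter_subset_inter_right _ fun v (hv : _ < _) => hv.trans hk)
    · obtain ⟨k, hk⟩ := exists_nat_one_div_lt hγ
      refine ⟨η k, hη k, ?_⟩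
      filter_upwards [hG, hsmall (θ k) (hθ0 k)] with δ hδ hδs w hw z hz hwz
      have hpath := (hδ.conn k hδs.le).2 w hw z hz hwz
      have hp : (fun F F' : HexVertex => hexGraph.Adj F F' ∧ F' ∈ (G δ).faces ∧
          dist ((δ : ℂ) * hexCenter w) ((δ : ℂ) * hexCenter F') < 2 * (1 / ((k : ℝ) + 1))) ≤
          (fun F F' : HexVertex => hexGraph.Adj F F' ∧ F' ∈ (G δ).faces ∧ dist ((δ : ℂ) * hexCenter w) ((δ : ℂ) * hexCenter F') < 2 * γ) :=
        fun F F' hFF' => ⟨hFF'.1, hFF'.2.1, by linarith [hFF'.2.2]⟩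
      exact Relation.ReflTransGen.mono hp w z hpath
  refine ⟨Gm, Gp, happrox Gm (heP.mono fun δ hδ => (hspec δ hδ).1.1), happrox Gp (heP.mono fun δ hδ => (hspec δ hδ).2.1),
    e, he, heP.mono fun δ hδ => ⟨?_, ?_⟩⟩
  · linarith [(hspec δ hδ).1.2]
  · linarith [(hspec δ hδ).2.2]

end ContApprox

end Summit.CriticalPhenomena.CardyFormulaZ2.Theorems

end
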